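import Summits.AtomisticToContinuum.BoseEinsteinCondensation.Theorems.BECTangentRigidityRigidMomentumBoundSoftCoreLinear
import Literature.MathematicalPhysics.QuantumManyBody.BoseEinsteinCondensation
import Mathlib.MeasureTheory.Integral.Lebesgue.Add
import HarnessLib

/-!
# Crux `RigidMomentumBound` (stmt-AtomisticToContinuum-13034), line `registered`, soft-core side-result:
# expected number of medium-range pairs in a state of finite soft-core energy

Supports (does not close) stmt-AtomisticToContinuum-13034. Given the pointwise pair-counting
inequalities (the conclusions of the registered stub `stub_pairCounting`, taken as a hypothesis),
for every normalised `Φ` of `N ≥ 1` particles: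

  `∫ #{pairs within 2R}(X) |Φ(X)|² dX ≤ 3 M N^{1/4} (N + ∫ #{pairs closer than r₀}(X) |Φ(X)|² dX)`,
  `M = (8R/r₀ + 2)³`,

and, for a pair potential `v = ofReal ∘ f` with `f ≥ c > 0` on `[0, r₀)` (soft core),
`ofReal c · ∫ #{close pairs} |Φ|² ≤ ∫ (∑_{i<j} v) |Φ|² ≤ ⟨Φ, H Φ⟩`. Folklore bookkeeping.
-/

noncomputable section

open MeasureTheory
open scoped ENNReal NNReal BigOperators

namespace Summit.AtomisticToContinuum.BoseEinsteinCondensation.Theorems.RigidMomentumBound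

open Literature.MathematicalPhysics.QuantumManyBody.BoseGas

namespace SoftCore

variable {N : ℕ}

/-! ### Counting bookkeeping -/

/-- The number of pairs `i < j` within distance `D` is at most `∑ᵢ #{j : dist(Xⱼ, Xᵢ) ≤ D}`
(registered sub-goal anchoring this helper file on the crux item; one logical header line). [folklore] -/
theorem card_pairs_le_sum_card : ∀ {N : ℕ} (X : Fin N → EuclideanSpace ℝ (Fin 3)) (D : ℝ), ((Finset.univ.filter fun p : Fin N × Fin N => p.1 < p.2 ∧ dist (X p.1) (X p.2) ≤ D).card : ℝ) ≤ ∑ i : Fin N, ((Finset.univ.filter fun j : Fin N => dist (X j) (X i) ≤ D).card : ℝ) := by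
  intro N X D
  have h1 : ((Finset.univ.filter fun p : Fin N × Fin N => p.1 < p.2 ∧ dist (X p.1) (X p.2) ≤ D).card : ℝ)
      ≤ ((Finset.univ.filter fun p : Fin N × Fin N => dist (X p.2) (X p.1) ≤ D).card : ℝ) := by
    exact_mod_cast Finset.card_le_card (Finset.monotone_filter_right _ fun p _ hp => by
      rw [dist_comm]; exact hp.2)
  refine h1.trans (le_of_eq ?_)
  rw [Finset.card_filter, ← Finset.univ_product_univ, Finset.sum_product]
  push_cast
  refine Finset.sum_congr rfl fun i _ => ?_
  rw [Finset.card_filter]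
  push_cast
  rfl

/-- Measurability of a pair count as a function of the configuration. [folklore] -/
theorem measurable_card_pairs (q : ℝ → Prop) [DecidablePred q] (hq : MeasurableSet {r | q r}) :
    Measurable fun X : Config N =>
      (((Finset.univ.filter fun p : Fin N × Fin N => p.1 < p.2 ∧ q (dist (X p.1) (X p.2))).card : ℕ) :
        ℝ≥0∞) := by
  have h : ∀ X : Config N,
      (((Finset.univ.filter fun p : Fin N × Fin N => p.1 < p.2 ∧ q (dist (X p.1) (X p.2))).card : ℕ) :
        ℝ≥0∞) = ∑ p : Fin N × Fin N, if p.1 < p.2 ∧ q (dist (X p.1) (X p.2)) then 1 else 0 := by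
    intro X
    rw [Finset.card_filter]
    push_cast
    rfl
  simp_rw [h]
  refine Finset.measurable_sum _ fun p _ => Measurable.ite ?_ measurable_const measurable_const
  by_cases hp : p.1 < p.2
  · have hset : {X : Config N | p.1 < p.2 ∧ q (dist (X p.1) (X p.2))} =
        {X : Config N | q (dist (X p.1) (X p.2))} := by
      ext X; simp [hp]
    rw [hset]
    exact hq.preimage (by fun_prop : Measurable fun X : Config N => dist (X p.1) (X p.2))
  · have hset : {X : Config N | p.1 < p.2 ∧ q (dist (X p.1) (X p.2))} = ∅ := by
      ext X; simp [hp]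
    rw [hset]
    exact MeasurableSet.empty

/-! ### The expected number of medium-range pairs -/

/-- **Pointwise**: from the pair-counting inequalities, `#{pairs within 2R} ≤ 3 M N^{1/4} (N + A)`
(`A` = number of close pairs, `M = (8R/r₀+2)³`, `N ≥ 1`). [folklore] -/
theorem card_pairs_le_linear (hN : 1 ≤ N) (X : Config N) {r₀ R : ℝ} (hr₀ : 0 < r₀) (hR : r₀ ≤ 2 * R)
    (hPC : (∀ i : Fin N,
        (((Finset.univ.filter fun j : Fin N => dist (X j) (X i) ≤ 2 * R).card : ℝ)) ^ 2 ≤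
          2 * (8 * R / r₀ + 2) ^ 3 *
              ((Finset.univ.filter fun p : Fin N × Fin N =>
                p.1 < p.2 ∧ dist (X p.1) (X p.2) < r₀).card : ℝ) +
            (8 * R / r₀ + 2) ^ 3 *
              ((Finset.univ.filter fun j : Fin N => dist (X j) (X i) ≤ 2 * R).card : ℝ)) ∧
      (∑ i : Fin N, ((Finset.univ.filter fun j : Fin N => dist (X j) (X i) ≤ 2 * R).card : ℝ)) ^ 2 ≤
        (N : ℝ) * (2 * (8 * R / r₀ + 2) ^ 3 *
            ((Finset.univ.filter fun p : Fin N × Fin N =>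
              p.1 < p.2 ∧ dist (X p.1) (X p.2) < r₀).card : ℝ) *
            ((Finset.univ.sup fun i : Fin N =>
              (Finset.univ.filter fun j : Fin N => dist (X j) (X i) ≤ 2 * R).card : ℕ) : ℝ) +
          (8 * R / r₀ + 2) ^ 3 *
            ∑ i : Fin N, ((Finset.univ.filter fun j : Fin N => dist (X j) (X i) ≤ 2 * R).card : ℝ))) :
    ((Finset.univ.filter fun p : Fin N × Fin N => p.1 < p.2 ∧ dist (X p.1) (X p.2) ≤ 2 * R).card : ℝ) ≤
      3 * (8 * R / r₀ + 2) ^ 3 * Real.sqrt (Real.sqrt N) *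
        (N + ((Finset.univ.filter fun p : Fin N × Fin N =>
          p.1 < p.2 ∧ dist (X p.1) (X p.2) < r₀).card : ℝ)) := by
  obtain ⟨h1, h2⟩ := hPC
  set M : ℝ := (8 * R / r₀ + 2) ^ 3 with hM
  set A : ℝ := ((Finset.univ.filter fun p : Fin N × Fin N =>
    p.1 < p.2 ∧ dist (X p.1) (X p.2) < r₀).card : ℝ) with hA
  set n : Fin N → ℕ := fun i => (Finset.univ.filter fun j : Fin N => dist (X j) (X i) ≤ 2 * R).card
    with hn
  have hRpos : 0 < R := by linarith
  have hM1 : 1 ≤ M := by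
    rw [hM]
    have : (1 : ℝ) ≤ 8 * R / r₀ + 2 := by
      have : 0 ≤ 8 * R / r₀ := by positivity
      linarith
    calc (1 : ℝ) = 1 ^ 3 := by norm_num
      _ ≤ (8 * R / r₀ + 2) ^ 3 := pow_le_pow_left₀ zero_le_one this 3
  have hN1 : (1 : ℝ) ≤ N := by exact_mod_cast hN
  have hA0 : 0 ≤ A := Nat.cast_nonneg _
  -- the maximal neighbour count `n*` and its inequality from part 1
  haveI : Nonempty (Fin N) := ⟨⟨0, hN⟩⟩
  obtain ⟨i₀, -, hi₀⟩ := Finset.exists_mem_eq_sup (Finset.univ : Finset (Fin N)) Finset.univ_nonempty n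
  have hnstar : (((Finset.univ.sup n : ℕ)) : ℝ) ^ 2 ≤ 2 * M * A + M * ((Finset.univ.sup n : ℕ) : ℝ) := by
    rw [hi₀]
    exact h1 i₀
  have hlin := pairSum_le_linear (S := ∑ i : Fin N, (n i : ℝ)) hM1 hN1 hA0 (Nat.cast_nonneg _) hnstar h2
  exact (card_pairs_le_sum_card X (2 * R)).trans hlin

/-- **In expectation**: for a normalised `Φ`,
`∫ #{pairs within 2R}|Φ|² ≤ 3 M N^{1/4} (N + ∫ #{close pairs}|Φ|²)`. [folklore] -/
theorem lintegral_card_pairs_le {L : ℝ} (hN : 1 ≤ N) (Φ : TrialState N L) {r₀ R : ℝ} (hr₀ : 0 < r₀)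
    (hR : r₀ ≤ 2 * R)
    (hPC : ∀ X : Config N, (∀ i : Fin N,
        (((Finset.univ.filter fun j : Fin N => dist (X j) (X i) ≤ 2 * R).card : ℝ)) ^ 2 ≤
          2 * (8 * R / r₀ + 2) ^ 3 *
              ((Finset.univ.filter fun p : Fin N × Fin N =>
                p.1 < p.2 ∧ dist (X p.1) (X p.2) < r₀).card : ℝ) +
            (8 * R / r₀ + 2) ^ 3 *
              ((Finset.univ.filter fun j : Fin N => dist (X j) (X i) ≤ 2 * R).card : ℝ)) ∧
      (∑ i : Fin N, ((Finset.univ.filter fun j : Fin N => dist (X j) (X i) ≤ 2 * R).card : ℝ)) ^ 2 ≤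
        (N : ℝ) * (2 * (8 * R / r₀ + 2) ^ 3 *
            ((Finset.univ.filter fun p : Fin N × Fin N =>
              p.1 < p.2 ∧ dist (X p.1) (X p.2) < r₀).card : ℝ) *
            ((Finset.univ.sup fun i : Fin N =>
              (Finset.univ.filter fun j : Fin N => dist (X j) (X i) ≤ 2 * R).card : ℕ) : ℝ) +
          (8 * R / r₀ + 2) ^ 3 *
            ∑ i : Fin N, ((Finset.univ.filter fun j : Fin N => dist (X j) (X i) ≤ 2 * R).card : ℝ))) :
    ∫⁻ X, (((Finset.univ.filter fun p : Fin N × Fin N =>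
        p.1 < p.2 ∧ dist (X p.1) (X p.2) ≤ 2 * R).card : ℕ) : ℝ≥0∞) * ((‖Φ.ψ X‖₊ : ℝ≥0∞)) ^ 2 ≤
      ENNReal.ofReal (3 * (8 * R / r₀ + 2) ^ 3 * Real.sqrt (Real.sqrt N)) *
        ((N : ℝ≥0∞) + ∫⁻ X, (((Finset.univ.filter fun p : Fin N × Fin N =>
          p.1 < p.2 ∧ dist (X p.1) (X p.2) < r₀).card : ℕ) : ℝ≥0∞) * ((‖Φ.ψ X‖₊ : ℝ≥0∞)) ^ 2) := by
  set K : ℝ := 3 * (8 * R / r₀ + 2) ^ 3 * Real.sqrt (Real.sqrt N) with hK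
  have hRpos : 0 < R := by linarith
  have hK0 : 0 ≤ K := by positivity
  have hmeasA : Measurable fun X : Config N => (((Finset.univ.filter fun p : Fin N × Fin N =>
      p.1 < p.2 ∧ dist (X p.1) (X p.2) < r₀).card : ℕ) : ℝ≥0∞) :=
    measurable_card_pairs (N := N) (fun r => r < r₀) measurableSet_Iio
  have hmeasΦ : Measurable fun X : Config N => ((‖Φ.ψ X‖₊ : ℝ≥0∞)) ^ 2 :=
    (Φ.contDiff.continuous.measurable.nnnorm.coe_nnreal_ennreal).pow_const 2
  -- pointwise bound, cast to `ℝ≥0∞`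
  have hpt : ∀ X : Config N, (((Finset.univ.filter fun p : Fin N × Fin N =>
        p.1 < p.2 ∧ dist (X p.1) (X p.2) ≤ 2 * R).card : ℕ) : ℝ≥0∞) ≤
      ENNReal.ofReal K * ((N : ℝ≥0∞) + (((Finset.univ.filter fun p : Fin N × Fin N =>
        p.1 < p.2 ∧ dist (X p.1) (X p.2) < r₀).card : ℕ) : ℝ≥0∞)) := by
    intro X
    have h := card_pairs_le_linear hN X hr₀ hR (hPC X)
    rw [← hK] at h
    have hcast : ∀ m : ℕ, ((m : ℕ) : ℝ≥0∞) = ENNReal.ofReal (m : ℝ) := fun m => by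
      rw [ENNReal.ofReal_natCast]
    simp only [hcast]
    rw [← ENNReal.ofReal_add (Nat.cast_nonneg _) (Nat.cast_nonneg _), ← ENNReal.ofReal_mul hK0]
    exact ENNReal.ofReal_le_ofReal h
  calc ∫⁻ X, (((Finset.univ.filter fun p : Fin N × Fin N =>
          p.1 < p.2 ∧ dist (X p.1) (X p.2) ≤ 2 * R).card : ℕ) : ℝ≥0∞) * ((‖Φ.ψ X‖₊ : ℝ≥0∞)) ^ 2
      ≤ ∫⁻ X, ENNReal.ofReal K * ((N : ℝ≥0∞) + (((Finset.univ.filter fun p : Fin N × Fin N =>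
          p.1 < p.2 ∧ dist (X p.1) (X p.2) < r₀).card : ℕ) : ℝ≥0∞)) * ((‖Φ.ψ X‖₊ : ℝ≥0∞)) ^ 2 :=
        lintegral_mono fun X => by have := hpt X; gcongr
    _ = ∫⁻ X, ENNReal.ofReal K * ((N : ℝ≥0∞) * ((‖Φ.ψ X‖₊ : ℝ≥0∞)) ^ 2 +
          (((Finset.univ.filter fun p : Fin N × Fin N =>
            p.1 < p.2 ∧ dist (X p.1) (X p.2) < r₀).card : ℕ) : ℝ≥0∞) * ((‖Φ.ψ X‖₊ : ℝ≥0∞)) ^ 2) :=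
        lintegral_congr fun X => by ring
    _ = ENNReal.ofReal K * ((N : ℝ≥0∞) * (∫⁻ X, ((‖Φ.ψ X‖₊ : ℝ≥0∞)) ^ 2) +
          ∫⁻ X, (((Finset.univ.filter fun p : Fin N × Fin N =>
            p.1 < p.2 ∧ dist (X p.1) (X p.2) < r₀).card : ℕ) : ℝ≥0∞) * ((‖Φ.ψ X‖₊ : ℝ≥0∞)) ^ 2) := by
        have hm1 : Measurable fun X : Config N => (N : ℝ≥0∞) * ((‖Φ.ψ X‖₊ : ℝ≥0∞)) ^ 2 :=
          hmeasΦ.const_mul _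
        have hm2 : Measurable fun X : Config N => (((Finset.univ.filter fun p : Fin N × Fin N =>
            p.1 < p.2 ∧ dist (X p.1) (X p.2) < r₀).card : ℕ) : ℝ≥0∞) * ((‖Φ.ψ X‖₊ : ℝ≥0∞)) ^ 2 :=
          hmeasA.mul hmeasΦ
        have hm12 : Measurable fun X : Config N => (N : ℝ≥0∞) * ((‖Φ.ψ X‖₊ : ℝ≥0∞)) ^ 2 +
            (((Finset.univ.filter fun p : Fin N × Fin N =>
              p.1 < p.2 ∧ dist (X p.1) (X p.2) < r₀).card : ℕ) : ℝ≥0∞) * ((‖Φ.ψ X‖₊ : ℝ≥0∞)) ^ 2 :=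
          hm1.add hm2
        rw [lintegral_const_mul _ hm12, lintegral_add_left hm1, lintegral_const_mul _ hmeasΦ]
    _ = _ := by rw [Φ.norm_eq, mul_one]

/-! ### The soft core controls the close pairs -/

/-- **Soft core**: if `f ≥ c` on `[0, r₀)` then `ofReal c · #{close pairs}(X) ≤ ∑_{i<j} ofReal (f |xᵢ-xⱼ|)`.
[folklore] -/
theorem ofReal_mul_card_le_interaction (X : Config N) {f : ℝ → ℝ} {c r₀ : ℝ}
    (hcore : ∀ r : ℝ, 0 ≤ r → r < r₀ → c ≤ f r) :
    ENNReal.ofReal c * (((Finset.univ.filter fun p : Fin N × Fin N =>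
        p.1 < p.2 ∧ dist (X p.1) (X p.2) < r₀).card : ℕ) : ℝ≥0∞) ≤
      interaction (fun r => ENNReal.ofReal (f r)) X := by
  -- rewrite the interaction as a sum over ordered pairs `p.1 < p.2`
  have hint : interaction (fun r => ENNReal.ofReal (f r)) X =
      ∑ p ∈ Finset.univ.filter (fun p : Fin N × Fin N => p.1 < p.2),
        ENNReal.ofReal (f (dist (X p.1) (X p.2))) := by
    unfold interaction
    rw [Finset.sum_filter, ← Finset.univ_product_univ, Finset.sum_product]
    refine Finset.sum_congr rfl fun i _ => ?_
    rw [Finset.sum_filter]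
  rw [hint]
  calc ENNReal.ofReal c * (((Finset.univ.filter fun p : Fin N × Fin N =>
          p.1 < p.2 ∧ dist (X p.1) (X p.2) < r₀).card : ℕ) : ℝ≥0∞)
      = ∑ p ∈ Finset.univ.filter (fun p : Fin N × Fin N => p.1 < p.2 ∧ dist (X p.1) (X p.2) < r₀),
          ENNReal.ofReal c := by
        rw [Finset.sum_const, nsmul_eq_mul, mul_comm]
    _ ≤ ∑ p ∈ Finset.univ.filter (fun p : Fin N × Fin N => p.1 < p.2 ∧ dist (X p.1) (X p.2) < r₀),
          ENNReal.ofReal (f (dist (X p.1) (X p.2))) := by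
        refine Finset.sum_le_sum fun p hp => ENNReal.ofReal_le_ofReal ?_
        rw [Finset.mem_filter] at hp
        exact hcore _ dist_nonneg hp.2.2
    _ ≤ ∑ p ∈ Finset.univ.filter (fun p : Fin N × Fin N => p.1 < p.2),
          ENNReal.ofReal (f (dist (X p.1) (X p.2))) := by
        refine Finset.sum_le_sum_of_subset_of_nonneg (fun p hp => ?_) fun _ _ _ => zero_le
        rw [Finset.mem_filter] at hp ⊢
        exact ⟨hp.1, hp.2.1⟩

/-- **Close pairs are controlled by the energy**: `ofReal c · ∫ #{close pairs}|Φ|² ≤ ⟨Φ, HΦ⟩` for a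
soft-core potential. [folklore] -/
theorem ofReal_mul_lintegral_card_le_energy {L : ℝ} (Φ : TrialState N L) {f : ℝ → ℝ} {c r₀ : ℝ}
    (hcore : ∀ r : ℝ, 0 ≤ r → r < r₀ → c ≤ f r) :
    ENNReal.ofReal c * ∫⁻ X, (((Finset.univ.filter fun p : Fin N × Fin N =>
        p.1 < p.2 ∧ dist (X p.1) (X p.2) < r₀).card : ℕ) : ℝ≥0∞) * ((‖Φ.ψ X‖₊ : ℝ≥0∞)) ^ 2 ≤
      energy (fun r => ENNReal.ofReal (f r)) Φ := by
  have hmeasA : Measurable fun X : Config N => (((Finset.univ.filter fun p : Fin N × Fin N =>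
      p.1 < p.2 ∧ dist (X p.1) (X p.2) < r₀).card : ℕ) : ℝ≥0∞) :=
    measurable_card_pairs (N := N) (fun r => r < r₀) measurableSet_Iio
  have hmeasΦ : Measurable fun X : Config N => ((‖Φ.ψ X‖₊ : ℝ≥0∞)) ^ 2 :=
    (Φ.contDiff.continuous.measurable.nnnorm.coe_nnreal_ennreal).pow_const 2
  have hm : Measurable fun X : Config N => (((Finset.univ.filter fun p : Fin N × Fin N =>
      p.1 < p.2 ∧ dist (X p.1) (X p.2) < r₀).card : ℕ) : ℝ≥0∞) * ((‖Φ.ψ X‖₊ : ℝ≥0∞)) ^ 2 :=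
    hmeasA.mul hmeasΦ
  rw [← lintegral_const_mul _ hm, energy]
  refine lintegral_mono fun X => ?_
  calc ENNReal.ofReal c * ((((Finset.univ.filter fun p : Fin N × Fin N =>
          p.1 < p.2 ∧ dist (X p.1) (X p.2) < r₀).card : ℕ) : ℝ≥0∞) * ((‖Φ.ψ X‖₊ : ℝ≥0∞)) ^ 2)
      = (ENNReal.ofReal c * (((Finset.univ.filter fun p : Fin N × Fin N =>
          p.1 < p.2 ∧ dist (X p.1) (X p.2) < r₀).card : ℕ) : ℝ≥0∞)) * ((‖Φ.ψ X‖₊ : ℝ≥0∞)) ^ 2 := by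
        ring
    _ ≤ interaction (fun r => ENNReal.ofReal (f r)) X * ((‖Φ.ψ X‖₊ : ℝ≥0∞)) ^ 2 := by
        have := ofReal_mul_card_le_interaction X hcore; gcongr
    _ ≤ _ := le_add_self

end SoftCore

end Summit.AtomisticToContinuum.BoseEinsteinCondensation.Theorems.RigidMomentumBound

end
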